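import Literature.Analysis.FluidPDE.ChaeWolfRemovingDSSBounds
import Literature.Analysis.FluidPDE.KNSSBlowupLimit
import HarnessLib

/-!
# Chae–Wolf 2017, Theorem 1.3 — the indirect argument: extraction of a self-similar limit

Analysis/FluidPDE proofs file (everything proved; no definitions, no named facts), second of three
files discharging `Literature.Analysis.FluidPDE.chaeWolf2017_removing_dss` (D. Chae, J. Wolf,
Comm. PDE 42 (2017) = arXiv:1610.09464, Theorem 1.3; proof §3, Step 2, arXiv pp. 8–9). Given a
sequence of nontrivial classical `c_n`-DSS solutions `(u_n, p_n)` on `ℝ³ × (−∞, 0)` with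
`c_n ↓ 1` and a common Type I constant `C₀`:

* `ChaeWolf.exists_witness` — Step 1 at a fixed scale: each `u_n` has a point `(t_n, x_n)`,
  `t_n ∈ [−c_n², −1]`, `‖x_n‖ ≤ 2C₀/ε₀`, with `‖u_n(t_n, x_n)‖ ≥ ε₀/2` (the smallness lemma
  `ChaeWolf.exists_eps_typeI_small_eq_zero` gives a point with `√(−t)‖u_n‖ > ε₀`; the discrete
  self-similarity, which preserves `√(−t)‖u‖`, moves it into one period);
* `ChaeWolf.exists_limit` — Step 2: along a subsequence `u_n → v` locally uniformly on
  `(−∞, −1/4] × ℝ³` (`ChaeWolf.exists_uniform_lipschitz` and the pointwise Arzelà–Ascoli theorem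
  `exists_strictMono_tendsto_of_lipschitzWith`), where `v` is continuous, obeys the Type I bound,
  is a bounded weak Navier–Stokes solution on `(−∞, −1/4)` (`isBoundedWeakNSSolutionOn_of_tendsto`,
  written for `t ↦ v(t − 1/4)` on `(−∞, 0)`), is **self-similar** — `v(t, x) = μv(μ²t, μx)` for
  all `μ ≥ 1` (printed for the vorticities: "`λ_j^{k_j} → μ` … `μ²ω(μx, μ²t) = ω(x,t)`"; run here
  on `u` itself, the time-equicontinuity being available) — and **nontrivial at time `−1`** (the
  witnesses accumulate, by compactness of `[−4, −1] × B̄(0, 2C₀/ε₀)`, at a point `(−1, x̄)` where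
  `‖v‖ ≥ ε₀/2`).

The printed compactness is in `V²`/`L³` (Banach–Alaoglu, Aubin–Lions, pressure bounds); for
classical solutions with the uniform Lipschitz bounds pointwise convergence suffices, the limit
equation being recovered in KNSS's pressure-free weak class.

## References

* D. Chae, J. Wolf, Comm. PDE 42 (2017) 1359–1374 = arXiv:1610.09464, §3, Steps 1–2 (arXiv
  pp. 8–9). [ChaeWolf2017RemovingDSS]
* G. Koch, N. Nadirashvili, G. Seregin, V. Šverák, Acta Math. 203 (2009) = arXiv:0709.3599, §4,
  Lemma 6.1. [KochNadirashviliSereginSverak2009]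
-/

noncomputable section

open MeasureTheory Set Function Filter Metric Real
open _root_.Topology
open scoped ENNReal NNReal ContDiff Laplacian

namespace Literature.Analysis.FluidPDE

namespace ChaeWolf


/-! ### Discrete self-similarity: iterates and the scale-invariant quantity -/

/-- Iterated discrete self-similarity: a `c`-DSS field is `cⁿ`-DSS for every `n`. [folklore] -/
theorem isDiscretelySelfSimilar_pow {c : ℝ}
    {u : ℝ → EuclideanSpace ℝ (Fin 3) → EuclideanSpace ℝ (Fin 3)} (h : IsDiscretelySelfSimilar c u)
    (n : ℕ) : IsDiscretelySelfSimilar (c ^ n) u := by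
  induction n with
  | zero => rw [pow_zero]; exact nsRescale_one u
  | succ n ih => rw [pow_succ']; exact h.mul ih

/-- Pointwise form of `μ`-DSS: `μ u(μ²t, μx) = u(t, x)`. [folklore] -/
theorem dss_apply_eq {μ : ℝ} {u : ℝ → EuclideanSpace ℝ (Fin 3) → EuclideanSpace ℝ (Fin 3)}
    (h : IsDiscretelySelfSimilar μ u) (t : ℝ) (x : EuclideanSpace ℝ (Fin 3)) :
    μ • u (μ ^ 2 * t) (μ • x) = u t x := by
  have := congr_fun (congr_fun h t) x
  rwa [nsRescale_apply] at this

/-- From a point where the scale-invariant quantity `√(−t) ‖u(t, x)‖` exceeds `ε₀`, at a time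
`t ∈ [−c², −1]`, `c ≤ 2`, the Type I bound confines `x` to the ball of radius `2C₀/ε₀` and gives
`‖u(t, x)‖ ≥ ε₀/2`. [folklore] -/
theorem witness_of_point {ε₀ C₀ c t : ℝ}
    {u : ℝ → EuclideanSpace ℝ (Fin 3) → EuclideanSpace ℝ (Fin 3)} {x : EuclideanSpace ℝ (Fin 3)}
    (hε₀ : 0 < ε₀) (hC₀ : 0 ≤ C₀) (hc0 : 0 ≤ c) (hc : c ≤ 2)
    (hI : HasTypeIDecay C₀ u) (ht : t ∈ Icc (-c ^ 2) (-1)) (hq : ε₀ < √(-t) * ‖u t x‖) :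
    ‖x‖ ≤ 2 * C₀ / ε₀ ∧ ε₀ / 2 ≤ ‖u t x‖ := by
  have ht0 : t < 0 := by linarith [ht.2]
  have hs0 : 0 < √(-t) := Real.sqrt_pos.2 (by linarith)
  have hs2 : √(-t) ≤ 2 := by
    rw [show (2 : ℝ) = √(2 ^ 2) by rw [Real.sqrt_sq (by norm_num)]]
    exact Real.sqrt_le_sqrt (by nlinarith [ht.1, hc0, hc])
  have hden : 0 < ‖x‖ + √(-t) := by positivity
  have hTI := hI t ht0 x
  constructor
  · -- `‖x‖ ε₀ < √(−t) (C₀ − ε₀) ≤ 2 C₀`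
    have h1 : ε₀ < √(-t) * (C₀ / (‖x‖ + √(-t))) := hq.trans_le (by gcongr)
    rw [mul_div_assoc', lt_div_iff₀ hden] at h1
    rw [le_div_iff₀ hε₀]
    nlinarith [norm_nonneg x, mul_nonneg hC₀ hs0.le]
  · rw [div_le_iff₀ (by norm_num : (0 : ℝ) < 2)]
    have h1 : ε₀ < 2 * ‖u t x‖ := hq.trans_le (by gcongr)
    linarith

/-- **Chae–Wolf 2017, proof of Thm. 1.3, Step 1: nontriviality survives at a fixed scale.** A
nontrivial `c`-DSS (`1 < c ≤ 2`) classical Type I solution has a point `(t, x)` with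
`t ∈ [−c², −1]`, `‖x‖ ≤ 2C₀/ε₀` and `‖u(t, x)‖ ≥ ε₀/2`, `ε₀` the constant of
`exists_eps_typeI_small_eq_zero` (a point with `√(−t)‖u‖ > ε₀` exists by that lemma, and is moved
into the period `[−c², −1]` by the discrete self-similarity, which preserves `√(−t)‖u‖`).
(Printed: "we must have `∫_{Q(0,1)} |u|³ > ε³`. Otherwise … `|u(x,t)| = λ^{-k}|u(λ^{-k}x, λ^{-2k}t)|
≤ Cλ^{-k} → 0`".) [cite: ChaeWolf2017RemovingDSS, §3 Step 1 (arXiv:1610.09464 p. 8)] -/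
theorem exists_witness {ε₀ C₀ : ℝ} (hε₀ : 0 < ε₀) (hC₀ : 0 ≤ C₀)
    (hA : ∀ {u : ℝ → EuclideanSpace ℝ (Fin 3) → EuclideanSpace ℝ (Fin 3)}
      {p : ℝ → EuclideanSpace ℝ (Fin 3) → ℝ}, IsClassicalNSSolutionOn (Iio 0) 1 0 u p →
      HasTypeIDecay C₀ u → (∀ t < 0, ∀ x, √(-t) * ‖u t x‖ ≤ ε₀) → ∀ t < 0, ∀ x, u t x = 0)
    {c : ℝ} (hc1 : 1 < c) (hc2 : c ≤ 2)
    {u : ℝ → EuclideanSpace ℝ (Fin 3) → EuclideanSpace ℝ (Fin 3)}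
    {p : ℝ → EuclideanSpace ℝ (Fin 3) → ℝ} (hcl : IsClassicalNSSolutionOn (Iio 0) 1 0 u p)
    (hdss : IsDiscretelySelfSimilar c u) (hI : HasTypeIDecay C₀ u) (hnt : ∃ t < 0, ∃ x, u t x ≠ 0) :
    ∃ t ∈ Icc (-c ^ 2) (-1), ∃ x : EuclideanSpace ℝ (Fin 3),
      ‖x‖ ≤ 2 * C₀ / ε₀ ∧ ε₀ / 2 ≤ ‖u t x‖ := by
  -- a point with a large scale-invariant quantity
  obtain ⟨t', ht', x', hq'⟩ : ∃ t' < 0, ∃ x', ε₀ < √(-t') * ‖u t' x'‖ := by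
    by_contra hcon
    push Not at hcon
    obtain ⟨t, ht, x, hx⟩ := hnt
    exact hx (hA hcl hI hcon t ht x)
  have hc0 : 0 < c := by linarith
  have hc2' : 1 < c ^ 2 := by nlinarith
  -- move it into the period `[-c², -1]`
  obtain ⟨t, ht, x, hq⟩ : ∃ t ∈ Icc (-c ^ 2) (-1), ∃ x, ε₀ < √(-t) * ‖u t x‖ := by
    rcases le_or_gt 1 (-t') with h1 | h1
    · -- scale down by `μ = cⁿ`
      obtain ⟨n, hn1, hn2⟩ := exists_nat_pow_near h1 hc2'
      set μ : ℝ := c ^ n with hμ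
      have hμ0 : 0 < μ := pow_pos hc0 n
      have hμ2 : μ ^ 2 = (c ^ 2) ^ n := by rw [hμ, ← pow_mul, ← pow_mul, mul_comm]
      have key := dss_apply_eq (isDiscretelySelfSimilar_pow hdss n) (t' / μ ^ 2) (μ⁻¹ • x')
      rw [← hμ, smul_smul, mul_inv_cancel₀ hμ0.ne', one_smul,
        mul_div_cancel₀ _ (pow_ne_zero 2 hμ0.ne')] at key
      refine ⟨t' / μ ^ 2, ⟨?_, ?_⟩, μ⁻¹ • x', ?_⟩
      · rw [neg_le, neg_div', div_le_iff₀ (pow_pos hμ0 2), hμ2, ← pow_succ']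
        exact hn2.le
      · rw [div_le_iff₀ (pow_pos hμ0 2), hμ2]
        linarith
      · rw [← key, norm_smul, Real.norm_of_nonneg hμ0.le,
          show -(t' / μ ^ 2) = -t' / μ ^ 2 by ring, Real.sqrt_div' _ (pow_pos hμ0 2).le,
          Real.sqrt_sq hμ0.le]
        have e : √(-t') / μ * (μ * ‖u t' x'‖) = √(-t') * ‖u t' x'‖ := by
          field_simp
        rwa [e]
    · -- scale up by `μ = cⁿ⁺¹`
      have hy0 : 0 < (c ^ 2)⁻¹ := by positivity
      have hy1 : (c ^ 2)⁻¹ < 1 := inv_lt_one_of_one_lt₀ hc2'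
      obtain ⟨n, hn1, hn2⟩ := exists_nat_pow_near_of_lt_one (by linarith) h1.le hy0 hy1
      set μ : ℝ := c ^ (n + 1) with hμ
      have hμ0 : 0 < μ := pow_pos hc0 (n + 1)
      have hμ2 : μ ^ 2 = (c ^ 2) ^ (n + 1) := by rw [hμ, ← pow_mul, ← pow_mul, mul_comm]
      have key := dss_apply_eq (isDiscretelySelfSimilar_pow hdss (n + 1)) t' x'
      rw [← hμ] at key
      refine ⟨μ ^ 2 * t', ⟨?_, ?_⟩, μ • x', ?_⟩
      · -- `-t' ≤ (c²)⁻¹ ^ n` gives `μ² (-t') ≤ c²`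
        rw [inv_pow] at hn2
        have : μ ^ 2 * -t' ≤ c ^ 2 := by
          rw [hμ2, pow_succ, mul_assoc]
          calc (c ^ 2) ^ n * (c ^ 2 * -t') ≤ (c ^ 2) ^ n * (c ^ 2 * ((c ^ 2) ^ n)⁻¹) := by
                gcongr
            _ = c ^ 2 := by field_simp
        linarith
      · -- `(c²)⁻¹ ^ (n+1) < -t'` gives `1 < μ² (-t')`
        rw [inv_pow, inv_lt_iff_one_lt_mul₀ (pow_pos (by positivity) (n + 1))] at hn1
        rw [hμ2]
        linarith
      · have hux : u (μ ^ 2 * t') (μ • x') = μ⁻¹ • u t' x' := by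
          rw [← key, smul_smul, inv_mul_cancel₀ hμ0.ne', one_smul]
        rw [hux, norm_smul, norm_inv, Real.norm_of_nonneg hμ0.le,
          show -(μ ^ 2 * t') = μ ^ 2 * -t' by ring, Real.sqrt_mul (pow_pos hμ0 2).le,
          Real.sqrt_sq hμ0.le]
        have e : μ * √(-t') * (μ⁻¹ * ‖u t' x'‖) = √(-t') * ‖u t' x'‖ := by
          field_simp
        rwa [e]
  exact ⟨t, ht, x, witness_of_point hε₀ hC₀ hc0.le hc2 hI ht hq⟩

/-! ### Equi-Lipschitz families: moving evaluation points -/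

/-- For a uniformly Lipschitz family `g n`, pointwise convergence `g n q₀ → y` at a point upgrades
to convergence `g n (q n) → y` along any sequence `q n → q₀`. [folklore] -/
theorem tendsto_apply_of_tendsto {X F : Type*} [PseudoMetricSpace X] [PseudoMetricSpace F]
    {K : ℝ≥0} {g : ℕ → X → F} (hg : ∀ n, LipschitzWith K (g n)) {q : ℕ → X} {q₀ : X}
    (hq : Tendsto q atTop (𝓝 q₀)) {y : F} (hy : Tendsto (fun n => g n q₀) atTop (𝓝 y)) :
    Tendsto (fun n => g n (q n)) atTop (𝓝 y) := by
  rw [tendsto_iff_dist_tendsto_zero] at hy ⊢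
  have hq' : Tendsto (fun n => dist (q n) q₀) atTop (𝓝 0) := tendsto_iff_dist_tendsto_zero.1 hq
  have hbound : ∀ n, dist (g n (q n)) y ≤ K * dist (q n) q₀ + dist (g n q₀) y := fun n =>
    (dist_triangle _ (g n q₀) _).trans (add_le_add ((hg n).dist_le_mul _ _) le_rfl)
  have hlim : Tendsto (fun n => (K : ℝ) * dist (q n) q₀ + dist (g n q₀) y) atTop (𝓝 0) := by
    simpa using (hq'.const_mul (K : ℝ)).add hy
  exact squeeze_zero (fun n => dist_nonneg) hbound hlim

/-! ### The extraction -/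

/-- **Chae–Wolf 2017, proof of Thm. 1.3, Step 2 (the indirect argument): extraction of the limit.**
Let `c_n ↓ 1` (`1 < c_n < 1 + 1/(n+1)`) and let `(u_n, p_n)` be nontrivial classical `c_n`-DSS
solutions on `ℝ³ × (−∞, 0)` with a common Type I bound `C₀`. Then a subsequence converges,
locally uniformly on `(−∞, −1/4] × ℝ³` (uniform Lipschitz bounds `exists_uniform_lipschitz` and
the pointwise Arzelà–Ascoli theorem `exists_strictMono_tendsto_of_lipschitzWith`), to a continuous
field `v` which: obeys the same Type I bound; is a bounded weak Navier–Stokes solution on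
`(−∞, −1/4)` (written for the shifted field `t ↦ v(t − 1/4)` on `(−∞, 0)`;
`isBoundedWeakNSSolutionOn_of_tendsto`); is **self-similar**, `v(t, x) = μ v(μ²t, μx)` for every
`μ ≥ 1` (printed: "`λ_j^{k_j} → μ` … Consequently `μ² ω(μx, μ²t) = ω(x, t)`", run here on `u`
itself thanks to the time-equicontinuity); and is **nontrivial at time `−1`** (the witnesses of
`exists_witness` accumulate at a point `(−1, x̄)`). [cite: ChaeWolf2017RemovingDSS, §3 Step 2 (arXiv:1610.09464 pp. 8–9)] -/
theorem exists_limit {C₀ : ℝ} (hC₀ : 0 < C₀) {c : ℕ → ℝ}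
    {u : ℕ → ℝ → EuclideanSpace ℝ (Fin 3) → EuclideanSpace ℝ (Fin 3)}
    {p : ℕ → ℝ → EuclideanSpace ℝ (Fin 3) → ℝ} (hc1 : ∀ n, 1 < c n)
    (hc2 : ∀ n, c n < 1 + 1 / ((n : ℝ) + 1))
    (hcl : ∀ n, IsClassicalNSSolutionOn (Iio 0) 1 0 (u n) (p n))
    (hdss : ∀ n, IsDiscretelySelfSimilar (c n) (u n)) (hI : ∀ n, HasTypeIDecay C₀ (u n))
    (hnt : ∀ n, ∃ t < 0, ∃ x, u n t x ≠ 0) :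
    ∃ v : ℝ → EuclideanSpace ℝ (Fin 3) → EuclideanSpace ℝ (Fin 3), Continuous (uncurry v) ∧
      (∀ t ≤ -(1 / 4 : ℝ), ∀ x, ‖v t x‖ ≤ C₀ / (‖x‖ + √(-t))) ∧
      IsBoundedWeakNSSolutionOn (Iio 0) isOpen_Iio 1 (fun t => v (t - 1 / 4)) ∧
      (∀ μ : ℝ, 1 ≤ μ → ∀ t ≤ -(1 / 4 : ℝ), ∀ x, v t x = μ • v (μ ^ 2 * t) (μ • x)) ∧
      ∃ x : (EuclideanSpace ℝ (Fin 3)), v (-1) x ≠ 0 := by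
  obtain ⟨K, L, hK, hL, hKL⟩ := exists_uniform_lipschitz hC₀.le
  obtain ⟨ε₀, hε₀, hA⟩ := exists_eps_typeI_small_eq_zero
  -- `c n → 1` and `c n ≤ 2`
  have hc_le2 : ∀ n, c n ≤ 2 := fun n => by
    have h1 : 1 / ((n : ℝ) + 1) ≤ 1 := by
      rw [div_le_one (by positivity)]; linarith [n.cast_nonneg (α := ℝ)]
    linarith [hc2 n]
  have hc_lim : Tendsto c atTop (𝓝 1) := by
    have h0 : Tendsto (fun n : ℕ => (1 : ℝ) + 1 / ((n : ℝ) + 1)) atTop (𝓝 1) := by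
      simpa using tendsto_const_nhds.add (tendsto_one_div_add_atTop_nhds_zero_nat (𝕜 := ℝ))
    exact tendsto_of_tendsto_of_tendsto_of_le_of_le tendsto_const_nhds h0 (fun n => (hc1 n).le)
      fun n => (hc2 n).le
  -- the equi-Lipschitz family on `ℝ × ℝ³` (fields frozen at time `-1/4` for later times)
  set Kx : ℝ≥0 := (K + L).toNNReal with hKx
  have hKx' : (Kx : ℝ) = K + L := by rw [hKx, Real.coe_toNNReal _ (by positivity)]
  set f : ℕ → ℝ × (EuclideanSpace ℝ (Fin 3)) → (EuclideanSpace ℝ (Fin 3)) :=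
    fun n q => u n (min q.1 (-(1 / 4 : ℝ))) q.2 with hf
  have hf_of_le : ∀ n {t : ℝ} (ht : t ≤ -(1 / 4 : ℝ)) (x : EuclideanSpace ℝ (Fin 3)),
      f n (t, x) = u n t x := fun n t ht x => by simp only [hf, min_eq_left ht]
  have hlip : ∀ n, LipschitzWith Kx (f n) := by
    intro n
    obtain ⟨hsp, htm⟩ := hKL (hcl n) (hI n)
    refine LipschitzWith.of_dist_le_mul fun q q' => ?_
    rw [hKx', dist_eq_norm, Prod.dist_eq, Real.dist_eq, dist_eq_norm]
    have hm : min q.1 (-(1 / 4 : ℝ)) ≤ -(1 / 4 : ℝ) := min_le_right _ _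
    have hm' : min q'.1 (-(1 / 4 : ℝ)) ≤ -(1 / 4 : ℝ) := min_le_right _ _
    have hmin : |min q.1 (-(1 / 4 : ℝ)) - min q'.1 (-(1 / 4 : ℝ))| ≤ |q.1 - q'.1| := by
      refine (abs_min_sub_min_le_max _ _ _ _).trans (max_le le_rfl ?_)
      rw [sub_self, abs_zero]; exact abs_nonneg _
    calc ‖u n (min q.1 (-(1 / 4))) q.2 - u n (min q'.1 (-(1 / 4))) q'.2‖
        ≤ ‖u n (min q.1 (-(1 / 4))) q.2 - u n (min q.1 (-(1 / 4))) q'.2‖ +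
            ‖u n (min q.1 (-(1 / 4))) q'.2 - u n (min q'.1 (-(1 / 4))) q'.2‖ :=
          norm_sub_le_norm_sub_add_norm_sub _ _ _
      _ ≤ K * ‖q.2 - q'.2‖ + L * |min q.1 (-(1 / 4 : ℝ)) - min q'.1 (-(1 / 4 : ℝ))| :=
          add_le_add (hsp _ hm _ _) (htm _ hm' _ hm _)
      _ ≤ K * max |q.1 - q'.1| ‖q.2 - q'.2‖ + L * max |q.1 - q'.1| ‖q.2 - q'.2‖ := by
          gcongr
          · exact le_max_right _ _
          · exact hmin.trans (le_max_left _ _)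
      _ = (K + L) * max |q.1 - q'.1| ‖q.2 - q'.2‖ := by ring
  have hball : ∀ n q, f n q ∈ closedBall (0 : EuclideanSpace ℝ (Fin 3)) (2 * C₀) :=
      fun n q => by
    rw [mem_closedBall, dist_zero_right]
    exact typeI_norm_le_two_mul hC₀.le (hI n) (min_le_right _ _) _
  obtain ⟨φ, l, hφ, hl, -, hlim⟩ := exists_strictMono_tendsto_of_lipschitzWith f hlip hball
  -- the limit field
  set v : ℝ → EuclideanSpace ℝ (Fin 3) → EuclideanSpace ℝ (Fin 3) := fun t x => l (t, x) with hv
  have hlimv : ∀ {t : ℝ} (ht : t ≤ -(1 / 4 : ℝ)) (x : EuclideanSpace ℝ (Fin 3)),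
      Tendsto (fun n => u (φ n) t x) atTop (𝓝 (v t x)) := by
    intro t ht x
    simpa only [hf_of_le _ ht] using hlim (t, x)
  have hvc : Continuous (uncurry v) := by
    have e : uncurry v = l := by funext q; rfl
    rw [e]; exact hl.continuous
  refine ⟨v, hvc, ?_, ?_, ?_, ?_⟩
  · -- the Type I bound passes to the limit
    intro t ht x
    exact le_of_tendsto' (hlimv ht x).norm fun n => hI (φ n) t (by linarith) x
  · -- bounded weak solution on `(-∞, -1/4)`, shifted to `(-∞, 0)`
    have hA' : Tendsto (fun k : ℕ => -(k : ℝ) + -1) atTop atBot :=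
      (tendsto_neg_atTop_atBot.comp tendsto_natCast_atTop_atTop).atBot_add tendsto_const_nhds
    have e14 : ∀ t : ℝ, t - 1 / 4 = t + -(1 / 4 : ℝ) := fun t => by ring
    have hV : ∀ k : ℕ, IsBoundedWeakNSSolutionOn (Ioo (-(k : ℝ) + -1) 0) isOpen_Ioo 1
        (fun t => u (φ k) (t - 1 / 4)) := by
      intro k
      have hcl' : IsClassicalNSSolutionOn (Ioo (-(k : ℝ) + -1 + -(1 / 4)) (-(1 / 4))) 1 0
          (u (φ k)) (p (φ k)) :=
        (hcl (φ k)).mono (fun t ht => by simp only [mem_Iio]; linarith [ht.2])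
          (uniqueDiffOn_Ioo _ _)
      have hbdd : IsBoundedOn (Ioo (-(k : ℝ) + -1 + -(1 / 4)) (-(1 / 4))) (u (φ k)) :=
        ⟨2 * C₀, fun t ht x => typeI_norm_le_two_mul hC₀.le (hI (φ k)) ht.2.le x⟩
      have h := (hcl'.isBoundedWeakNSSolutionOn hbdd).comp_add_right (-(1 / 4 : ℝ))
        (J := Ioo (-(k : ℝ) + -1) 0) isOpen_Ioo fun t => by
          simp only [mem_Ioo]
          constructor <;> intro h <;> constructor <;> linarith [h.1, h.2]
      simpa only [e14] using h
    have hcont : ∀ k : ℕ, ContinuousOn (uncurry fun t => u (φ k) (t - 1 / 4))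
        (Ioo (-(k : ℝ) + -1) 0 ×ˢ univ) := by
      intro k
      have h1 := ((hcl (φ k)).smooth_velocity.comp_add_right (-(1 / 4 : ℝ))).continuousOn
      refine (h1.mono (prod_mono (fun t ht => ?_) Subset.rfl)).congr fun q _ => by
        simp only [uncurry, e14]
      simp only [mem_preimage, mem_Iio]
      linarith [ht.2]
    have hbd : ∀ k : ℕ, ∀ t ∈ Ioo (-(k : ℝ) + -1) 0, ∀ x,
        ‖u (φ k) (t - 1 / 4) x‖ ≤ 2 * C₀ :=
      fun k t ht x => typeI_norm_le_two_mul hC₀.le (hI (φ k)) (by linarith [ht.2]) x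
    have hvc' : Continuous (uncurry fun t x => v (t - 1 / 4) x) :=
      hvc.comp ((continuous_fst.sub continuous_const).prodMk continuous_snd)
    exact isBoundedWeakNSSolutionOn_of_tendsto hA' hV hcont hbd hvc'
      fun t ht x => hlimv (by linarith) x
  · -- self-similarity of the limit
    intro μ hμ t ht x
    rcases hμ.eq_or_lt with rfl | hμ1
    · simp
    have ht0 : t ≤ 0 := by linarith
    -- `λ n = (c n)^(k n) → μ`
    choose k hk using fun n => exists_nat_pow_near hμ (hc1 n)
    set lam : ℕ → ℝ := fun n => c n ^ k n with hlam
    have hlam1 : ∀ n, 1 ≤ lam n := fun n => one_le_pow₀ (hc1 n).le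
    have hlamμ : ∀ n, lam n ≤ μ := fun n => (hk n).1
    have hμlam : ∀ n, μ / c n ≤ lam n := fun n => by
      rw [div_le_iff₀ (by linarith [hc1 n]), hlam, ← pow_succ]
      exact (hk n).2.le
    have hlam_lim : Tendsto lam atTop (𝓝 μ) := by
      have h0 : Tendsto (fun n => μ / c n) atTop (𝓝 μ) := by
        have h' := (tendsto_const_nhds (x := μ)).div hc_lim one_ne_zero
        rw [div_one] at h'
        exact Tendsto.congr (fun n => rfl) h'
      exact tendsto_of_tendsto_of_tendsto_of_le_of_le h0 tendsto_const_nhds hμlam hlamμ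
    have hlamφ : Tendsto (lam ∘ φ) atTop (𝓝 μ) := hlam_lim.comp hφ.tendsto_atTop
    -- the DSS identity along the subsequence
    have hid : ∀ n, u (φ n) t x =
        lam (φ n) • u (φ n) (lam (φ n) ^ 2 * t) (lam (φ n) • x) := fun n =>
      (dss_apply_eq (isDiscretelySelfSimilar_pow (hdss (φ n)) (k (φ n))) t x).symm
    -- the moving points stay in `t ≤ -1/4`
    have hmem : ∀ s : ℝ, 1 ≤ s → s ^ 2 * t ≤ -(1 / 4 : ℝ) := fun s hs =>
      (mul_le_of_one_le_left ht0 (one_le_pow₀ hs)).trans ht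
    set q : ℕ → ℝ × EuclideanSpace ℝ (Fin 3) :=
      fun n => (lam (φ n) ^ 2 * t, lam (φ n) • x) with hq
    have hqlim : Tendsto q atTop (𝓝 (μ ^ 2 * t, μ • x)) :=
      ((hlamφ.pow 2).mul_const t).prodMk_nhds (hlamφ.smul tendsto_const_nhds)
    have h1 : Tendsto (fun n => f (φ n) (q n)) atTop (𝓝 (v (μ ^ 2 * t) (μ • x))) :=
      tendsto_apply_of_tendsto (fun n => hlip (φ n)) hqlim (hlim (μ ^ 2 * t, μ • x))
    have h2 : Tendsto (fun n => u (φ n) t x) atTop (𝓝 (μ • v (μ ^ 2 * t) (μ • x))) := by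
      refine (hlamφ.smul h1).congr fun n => ?_
      simp only [comp_apply, hq, hf_of_le _ (hmem _ (hlam1 _))]
      exact (hid n).symm
    exact tendsto_nhds_unique (hlimv ht x) h2
  · -- nontriviality at time `-1`
    choose tw htw xw hxw hnw using fun n =>
      exists_witness hε₀ hC₀.le (fun hu hIu hsu => hA hC₀.le hu hIu hsu) (hc1 n) (hc_le2 n)
        (hcl n) (hdss n) (hI n) (hnt n)
    set S : Set (ℝ × (EuclideanSpace ℝ (Fin 3))) :=
      Icc (-4 : ℝ) (-1) ×ˢ closedBall (0 : EuclideanSpace ℝ (Fin 3)) (2 * C₀ / ε₀) with hS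
    have hSc : IsCompact S := isCompact_Icc.prod (isCompact_closedBall _ _)
    have hmemS : ∀ n, (tw (φ n), xw (φ n)) ∈ S := fun n => by
      refine mk_mem_prod ⟨?_, (htw (φ n)).2⟩ ?_
      · have : c (φ n) ^ 2 ≤ 4 := by nlinarith [hc_le2 (φ n), hc1 (φ n)]
        linarith [(htw (φ n)).1]
      · rw [mem_closedBall, dist_zero_right]; exact hxw (φ n)
    obtain ⟨⟨tbar, xbar⟩, -, ψ, hψ, hconv⟩ := hSc.tendsto_subseq hmemS
    -- the limit time is `-1`
    have ht1 : Tendsto (fun n => tw (φ (ψ n))) atTop (𝓝 (-1)) := by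
      have hlow : Tendsto (fun n => -(c (φ (ψ n))) ^ 2) atTop (𝓝 (-1)) := by
        have := ((hc_lim.comp hφ.tendsto_atTop).comp hψ.tendsto_atTop).pow 2
        simpa using this.neg
      exact tendsto_of_tendsto_of_tendsto_of_le_of_le hlow tendsto_const_nhds
        (fun n => (htw _).1) fun n => (htw _).2
    have htbar : tbar = -1 :=
      tendsto_nhds_unique ((continuous_fst.tendsto _).comp hconv) ht1
    subst htbar
    refine ⟨xbar, fun h0 => ?_⟩
    -- `u_{φ ψ n}(t_n, x_n) → v(-1, xbar)`
    have h14 : (-1 : ℝ) ≤ -(1 / 4 : ℝ) := by norm_num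
    have hy : Tendsto (fun n => f (φ (ψ n)) ((-1 : ℝ), xbar)) atTop (𝓝 (v (-1) xbar)) :=
      (hlim ((-1 : ℝ), xbar)).comp hψ.tendsto_atTop
    have hmain := tendsto_apply_of_tendsto (fun n => hlip (φ (ψ n))) hconv hy
    have hge : ε₀ / 2 ≤ ‖v (-1) xbar‖ := by
      refine ge_of_tendsto' hmain.norm fun n => ?_
      simp only [comp_apply, hf_of_le _ ((htw _).2.trans h14)]
      exact hnw (φ (ψ n))
    rw [h0, norm_zero] at hge
    linarith


end ChaeWolf

end Literature.Analysis.FluidPDE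

end
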